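import Summits.ResolutionOfSingularities.ResolutionOfSingularities.Theorems.FrobeniusLadderFInjectiveMacaulayficationCIChartPresentationRange
import HarnessLib

/-!
# CI chart presentation (C1ᶜⁱ), part 2: the kernel of `Ψ_F` — strict transforms, the total transform, and the presentation
# under the saturation binder (crux `FInjectiveMacaulayfication`, CI-CN engine kernel, CRUX-PLAN w45a v8 R9.1 piece C1ᶜⁱ)

[OURS · L1 W4.5a] Support file for crux stmt-ResolutionOfSingularities-15315 (seat res-L1-w45a-stub-1). AI-written, weaker than expert
review; no statement of [claim: Hironaka2017] is used. Continues `CIChartPresentationRange`: `F` an ARBITRARY ideal of `k[X]`, `R = k[X] ⧸ F`,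
chart data `V` (unimodular), `m`, `a i` (`E (a i) = E m + e_i`), `θ x^e = Y^{E e}`, `u = x̄^m`, `Ψ_F : k[Y] → R[1/u]`, `Y_i ↦ x̄^{a i}/u`.

* §1 `psi_monomial_coeff_mul_pow` — `Ψ_F` on monomials with coefficients (bookkeeping).
* §2 STRICT TRANSFORMS DIE: `psi_eq_zero_of_theta_eq` — if `q ∈ F` and `θ q = Y^d · g` then `Ψ_F g = 0`, provided `x^{Σ dᵢ • a i}` divides
  a power of `x^m` (`hunit`, decidable per specimen; then `Ψ_F(Y^d)` is a unit); `psi_eq_zero_of_theta_eq_of_isPrime` — the same with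
  `F` prime and no `x̄ⱼ = 0` instead of `hunit` (`R[1/u]` is a domain and `Ψ_F(Y^d) ≠ 0`).
* §3 THE KERNEL LIES IN THE SATURATION OF THE TOTAL TRANSFORM: `exists_monomial_mul_mem_map_of_psi_eq_zero` — if `Ψ_F h = 0` then
  `Y^e · h ∈ θ(F)·k[Y]` for some monomial `Y^e` (clear denominators, pull back along `θ`); NO hypothesis on `F`.
* §4 `exists_ciChartPresentation` — for a complete intersection `F = (F₁, …, F_c)` with strict transforms `θ Fᵢ = Y^{dᵢ} gᵢ` (+ `hunit`),
  UNDER THE SATURATION BINDER `hsat : Y^e h ∈ (g) ⇒ h ∈ (g)` (every variable a non-zero-divisor modulo `(g₁, …, g_c)`; for `c = 1` this is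
  `hcop` of `MonomialChartPresentationKernel`), the chart map induces a ring ISOMORPHISM `k[Y]/(g₁, …, g_c) ≅ R[I_A R/u]` onto the affine
  blow-up algebra (stated as a bijective ring hom, as in (C1)), with `θ q ↦ q̄/1`. The binder is discharged LOCALLY from the expected
  dimension in the sequel `CIChartPresentationLocal` (tri-1 F17).
No definition is declared. [folklore: affine toric charts of monomial blow-ups; strict vs total transform, Cox–Little–Schenck §2.3/§10/§11]
-/

set_option linter.dupNamespace false

noncomputable section

open MvPolynomial

namespace Summit.ResolutionOfSingularities.ResolutionOfSingularities.Theorems.FInjectiveMacaulayfication.CIChartPresentationKernel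

open Summit.ResolutionOfSingularities.ResolutionOfSingularities.Theorems.FInjectiveMacaulayfication

variable {n : ℕ} {k : Type} [Field k] (F : Ideal (MvPolynomial (Fin n) k)) (V : Matrix (Fin n) (Fin n) ℕ)
  (hV : IsUnit (V.map (Nat.cast : ℕ → ℤ)).det) (m : Fin n →₀ ℕ) (a : Fin n → (Fin n →₀ ℕ))
  (hgen : ∀ i : Fin n, (Finsupp.equivFunOnFinite.symm (V.mulVec ⇑(a i)) : Fin n →₀ ℕ) =
    Finsupp.equivFunOnFinite.symm (V.mulVec ⇑m) + Finsupp.single i 1)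

/-! ## §1 `Ψ_F` on monomials with coefficients -/

/-- `Ψ_F (monomial c r) · (x̄^m/1)^{|c|} = (r • x^{Σ cᵢ • a i})‾/1`. [folklore] -/
theorem psi_monomial_coeff_mul_pow (c : Fin n →₀ ℕ) (r : k) :
    aeval (fun i : Fin n => algebraMap (MvPolynomial (Fin n) k ⧸ F)
        (Localization.Away (Ideal.Quotient.mk F (monomial m (1 : k))))
        (Ideal.Quotient.mk F (monomial (a i) (1 : k))) *
      IsLocalization.Away.invSelf (Ideal.Quotient.mk F (monomial m (1 : k)))) (monomial c r) *
      (algebraMap (MvPolynomial (Fin n) k ⧸ F)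
        (Localization.Away (Ideal.Quotient.mk F (monomial m (1 : k))))
        (Ideal.Quotient.mk F (monomial m (1 : k)))) ^ (∑ i : Fin n, c i) =
      algebraMap (MvPolynomial (Fin n) k ⧸ F)
        (Localization.Away (Ideal.Quotient.mk F (monomial m (1 : k))))
        (Ideal.Quotient.mk F (monomial (∑ i : Fin n, c i • a i) r)) := by
  set R := MvPolynomial (Fin n) k ⧸ F
  set u : R := Ideal.Quotient.mk F (monomial m (1 : k)) with hu
  set L := Localization.Away u
  have h1 := CIChartPresentationRange.psi_monomial_mul_pow F m a c
  have hcr : (monomial c r : MvPolynomial (Fin n) k) = C r * monomial c 1 := by rw [C_mul_monomial, mul_one]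
  have hcr' : (monomial (∑ i : Fin n, c i • a i) r : MvPolynomial (Fin n) k) = C r * monomial (∑ i : Fin n, c i • a i) 1 := by
    rw [C_mul_monomial, mul_one]
  rw [hcr, map_mul, mul_assoc, h1, hcr', map_mul, map_mul, aeval_C, IsScalarTower.algebraMap_apply k R L]
  congr 1

/-! ## §2 Strict transforms of members of `F` die under `Ψ_F` -/

section StrictTransform

include hV hgen

/-- **Strict transforms die**: if `q ∈ F` and `θ q = Y^d · g`, then `Ψ_F g = 0`, provided `x^{Σ dᵢ • a i}` divides a power of `x^m`
(`hunit`; then `Ψ_F(Y^d)` is a unit and `Ψ_F(Y^d) Ψ_F(g) = Ψ_F(θ q) = q̄/1 = 0`). [folklore] -/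
theorem psi_eq_zero_of_theta_eq {q : MvPolynomial (Fin n) k} (hq : q ∈ F) {d : Fin n →₀ ℕ} {g : MvPolynomial (Fin n) k}
    (hθq : aeval (fun j : Fin n => ∏ i : Fin n, (X i : MvPolynomial (Fin n) k) ^ V i j) q = monomial d (1 : k) * g)
    (hunit : ∃ (N : ℕ) (r : Fin n →₀ ℕ), N • m = ∑ i : Fin n, d i • a i + r) :
    aeval (fun i : Fin n => algebraMap (MvPolynomial (Fin n) k ⧸ F)
        (Localization.Away (Ideal.Quotient.mk F (monomial m (1 : k))))
        (Ideal.Quotient.mk F (monomial (a i) (1 : k))) *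
      IsLocalization.Away.invSelf (Ideal.Quotient.mk F (monomial m (1 : k)))) g = 0 := by
  set R := MvPolynomial (Fin n) k ⧸ F
  set u : R := Ideal.Quotient.mk F (monomial m (1 : k)) with hu
  set L := Localization.Away u
  set Ψ : MvPolynomial (Fin n) k →ₐ[k] L := aeval (fun i : Fin n => algebraMap R L
    (Ideal.Quotient.mk F (monomial (a i) (1 : k))) * IsLocalization.Away.invSelf u) with hΨ
  obtain ⟨N, r, hNr⟩ := hunit
  have hU1 : IsUnit (algebraMap R L u) := IsLocalization.Away.algebraMap_isUnit u
  -- `Ψ(Y^d)` is a unit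
  have hmono : IsUnit (Ψ (monomial d (1 : k))) := by
    have h1 := CIChartPresentationRange.psi_monomial_mul_pow F m a d
    have h2 : IsUnit (algebraMap R L (Ideal.Quotient.mk F (monomial (∑ i : Fin n, d i • a i) (1 : k)))) := by
      refine isUnit_of_mul_isUnit_left (y := algebraMap R L (Ideal.Quotient.mk F (monomial r (1 : k)))) ?_
      rw [← map_mul, ← map_mul, monomial_mul, mul_one, ← hNr, ← one_pow N, ← monomial_pow, map_pow, map_pow]
      exact hU1.pow N
    rw [← h1] at h2
    exact isUnit_of_mul_isUnit_left h2
  -- `Ψ(Y^d) Ψ(g) = Ψ(θ q) = 0`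
  have h0 : Ψ (monomial d (1 : k)) * Ψ g = 0 := by
    rw [← map_mul, ← hθq, hΨ, CIChartPresentationRange.psi_theta F V hV m a hgen q,
      Ideal.Quotient.eq_zero_iff_mem.mpr hq, map_zero]
  exact (hmono.mul_right_eq_zero).mp h0

/-- **Strict transforms die, prime form**: if `F` is prime with no `x̄ⱼ = 0`, `q ∈ F` and `θ q = Y^d · g`, then `Ψ_F g = 0`
(`R[1/u]` is a domain in which `Ψ_F(Y^d) ≠ 0`). [folklore] -/
theorem psi_eq_zero_of_theta_eq_of_isPrime (hprime : F.IsPrime) (hXne : ∀ j : Fin n, Ideal.Quotient.mk F (X j) ≠ 0)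
    {q : MvPolynomial (Fin n) k} (hq : q ∈ F) {d : Fin n →₀ ℕ} {g : MvPolynomial (Fin n) k}
    (hθq : aeval (fun j : Fin n => ∏ i : Fin n, (X i : MvPolynomial (Fin n) k) ^ V i j) q = monomial d (1 : k) * g) :
    aeval (fun i : Fin n => algebraMap (MvPolynomial (Fin n) k ⧸ F)
        (Localization.Away (Ideal.Quotient.mk F (monomial m (1 : k))))
        (Ideal.Quotient.mk F (monomial (a i) (1 : k))) *
      IsLocalization.Away.invSelf (Ideal.Quotient.mk F (monomial m (1 : k)))) g = 0 := by
  classical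
  haveI := hprime
  haveI : IsDomain (MvPolynomial (Fin n) k ⧸ F) := Ideal.Quotient.isDomain _
  have hmon : ∀ e : Fin n →₀ ℕ, Ideal.Quotient.mk F (monomial e (1 : k)) ≠ 0 := by
    intro e
    rw [monomial_eq, C_1, one_mul, Finsupp.prod, map_prod]
    exact Finset.prod_ne_zero_iff.mpr fun j _ => by rw [map_pow]; exact pow_ne_zero _ (hXne j)
  haveI : IsDomain (Localization.Away (Ideal.Quotient.mk F (monomial m (1 : k)))) :=
    IsLocalization.isDomain_localization (powers_le_nonZeroDivisors_of_noZeroDivisors (hmon m))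
  have hinj : Function.Injective (algebraMap (MvPolynomial (Fin n) k ⧸ F)
      (Localization.Away (Ideal.Quotient.mk F (monomial m (1 : k))))) :=
    IsLocalization.injective _ (powers_le_nonZeroDivisors_of_noZeroDivisors (hmon m))
  -- `Ψ(θ q) = q̄/1 = 0`
  have hθ := CIChartPresentationRange.psi_theta F V hV m a hgen q
  rw [hθq, map_mul, Ideal.Quotient.eq_zero_iff_mem.mpr hq, map_zero] at hθ
  refine (mul_eq_zero.mp hθ).resolve_left ?_
  -- `Ψ(Y^d) ≠ 0`
  rw [aeval_monomial, map_one (algebraMap k (Localization.Away (Ideal.Quotient.mk F (monomial m (1 : k))))),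
    one_mul, Finsupp.prod]
  refine Finset.prod_ne_zero_iff.mpr fun i _ => pow_ne_zero _ (mul_ne_zero ?_ ?_)
  · exact fun h0 => hmon (a i) (hinj (by rw [h0, map_zero]))
  · exact (IsUnit.of_mul_eq_one (a := IsLocalization.Away.invSelf (S := Localization.Away (Ideal.Quotient.mk F
      (monomial m (1 : k)))) (Ideal.Quotient.mk F (monomial m (1 : k)))) _
      (by rw [mul_comm]; exact IsLocalization.Away.mul_invSelf _)).ne_zero

end StrictTransform

/-! ## §3 The kernel lies in the monomial saturation of the total transform -/

section Kernel

include hgen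

/-- **`ker Ψ_F ⊆ (θ(F)·k[Y] : Y^∞)`**: if `Ψ_F h = 0` then `Y^e · h` lies in the TOTAL TRANSFORM ideal `θ(F)·k[Y]` for some monomial
`Y^e`. Proof: with `D ≥ |c|` for all monomials `Y^c` of `h`, `(u/1)^D Ψ_F(h) = H̄/1` for `H = Σ_c h_c x^{ε_c}` and `θ H = Y^{D • E m} h`;
`H̄/1 = 0` gives `(x^m)^N H ∈ F`, and applying `θ`, `Y^{N • E m} Y^{D • E m} h ∈ θ(F)·k[Y]`. No hypothesis on `F`. [folklore] -/
theorem exists_monomial_mul_mem_map_of_psi_eq_zero (h : MvPolynomial (Fin n) k)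
    (hh : aeval (fun i : Fin n => algebraMap (MvPolynomial (Fin n) k ⧸ F)
        (Localization.Away (Ideal.Quotient.mk F (monomial m (1 : k))))
        (Ideal.Quotient.mk F (monomial (a i) (1 : k))) *
      IsLocalization.Away.invSelf (Ideal.Quotient.mk F (monomial m (1 : k)))) h = 0) :
    ∃ e : Fin n →₀ ℕ, monomial e (1 : k) * h ∈
      F.map (aeval (fun j : Fin n => ∏ i : Fin n, (X i : MvPolynomial (Fin n) k) ^ V i j)).toRingHom := by
  classical
  set R := MvPolynomial (Fin n) k ⧸ F
  set u : R := Ideal.Quotient.mk F (monomial m (1 : k)) with hu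
  set L := Localization.Away u
  set Ψ : MvPolynomial (Fin n) k →ₐ[k] L := aeval (fun i : Fin n => algebraMap R L
    (Ideal.Quotient.mk F (monomial (a i) (1 : k))) * IsLocalization.Away.invSelf u) with hΨ
  set θ : MvPolynomial (Fin n) k →ₐ[k] MvPolynomial (Fin n) k :=
    aeval (fun j : Fin n => ∏ i : Fin n, (X i : MvPolynomial (Fin n) k) ^ V i j) with hθ
  set Em : Fin n →₀ ℕ := Finsupp.equivFunOnFinite.symm (V.mulVec ⇑m) with hEm
  -- the bound `D` and the numerator `H`
  set D : ℕ := h.support.sup (fun c => ∑ i : Fin n, c i) with hD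
  have hDle : ∀ c ∈ h.support, ∑ i : Fin n, c i ≤ D := fun c hc => Finset.le_sup (f := fun c => ∑ i : Fin n, c i) hc
  set H : MvPolynomial (Fin n) k :=
    ∑ c ∈ h.support, monomial (∑ i : Fin n, c i • a i + (D - ∑ i : Fin n, c i) • m) (coeff c h) with hH
  -- (A) `Ψ h · (u/1)^D = H̄/1`
  have hA : Ψ h * algebraMap R L u ^ D = algebraMap R L (Ideal.Quotient.mk F H) := by
    conv_lhs => rw [h.as_sum, map_sum, Finset.sum_mul]
    rw [hH, map_sum, map_sum]
    refine Finset.sum_congr rfl fun c hc => ?_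
    have hR : ∀ j : ℕ, Ideal.Quotient.mk F (monomial (∑ i : Fin n, c i • a i) (coeff c h)) * u ^ j =
        Ideal.Quotient.mk F (monomial (∑ i : Fin n, c i • a i + j • m) (coeff c h)) := fun j => by
      rw [hu, ← map_pow, ← map_mul, monomial_pow, one_pow, monomial_mul, mul_one]
    rw [← Nat.add_sub_of_le (hDle c hc), pow_add, ← mul_assoc, hΨ, psi_monomial_coeff_mul_pow F m a c (coeff c h),
      Nat.add_sub_cancel_left, ← map_pow, ← map_mul, hR]
  -- (B) `θ H = Y^{D • E m} · h`
  have hB : θ H = monomial (D • Em) (1 : k) * h := by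
    rw [hH, map_sum]
    conv_rhs => rw [h.as_sum, Finset.mul_sum]
    refine Finset.sum_congr rfl fun c hc => ?_
    rw [hθ, ToricChartFedder.theta_monomial, MonomialChartPresentationRange.expMap_eps V m a hgen c D (hDle c hc),
      monomial_mul, one_mul]
  -- `Ψ h = 0` ⇒ `H̄/1 = 0` ⇒ `u^N H̄ = 0` ⇒ `(x^m)^N H ∈ F`
  rw [hh, zero_mul] at hA
  obtain ⟨⟨uN, huN'⟩, hN⟩ := (IsLocalization.map_eq_zero_iff (Submonoid.powers u) L _).mp hA.symm
  obtain ⟨N, huN⟩ := (Submonoid.mem_powers_iff _ _).mp huN'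
  simp only at hN
  rw [← huN, hu, ← map_pow, ← map_mul, Ideal.Quotient.eq_zero_iff_mem] at hN
  -- apply `θ`
  have hθN : θ ((monomial m (1 : k)) ^ N * H) ∈ F.map θ.toRingHom := Ideal.mem_map_of_mem _ hN
  rw [map_mul, map_pow, hB, hθ, ToricChartFedder.theta_monomial, ← hEm, ← mul_assoc, monomial_pow, one_pow, monomial_mul,
    one_mul] at hθN
  exact ⟨N • Em + D • Em, hθN⟩

end Kernel

/-! ## §4 The presentation of the chart, under the saturation binder -/

section Presentation

variable (A : Finset (Fin n →₀ ℕ)) (haA : ∀ i, a i ∈ A)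
  (hge : ∀ e ∈ A, (Finsupp.equivFunOnFinite.symm (V.mulVec ⇑m) : Fin n →₀ ℕ) ≤
    Finsupp.equivFunOnFinite.symm (V.mulVec ⇑e))
  {c : ℕ} (Fs gs : Fin c → MvPolynomial (Fin n) k) (d : Fin c → (Fin n →₀ ℕ))
  (hθF : ∀ i : Fin c, aeval (fun j : Fin n => ∏ l : Fin n, (X l : MvPolynomial (Fin n) k) ^ V l j) (Fs i) =
    monomial (d i) (1 : k) * gs i)
  (hunit : ∀ i : Fin c, ∃ (N : ℕ) (r : Fin n →₀ ℕ), N • m = ∑ j : Fin n, d i j • a j + r)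
  (hsat : ∀ (e : Fin n →₀ ℕ) (h : MvPolynomial (Fin n) k), monomial e (1 : k) * h ∈ Ideal.span (Set.range gs) →
    h ∈ Ideal.span (Set.range gs))
include hV hgen haA hge hθF hunit hsat

/-- **CI CHART PRESENTATION (global form, saturation binder).** Data: the chart (`V`, `m`, `a i`, `A` as in (C1)); a complete
intersection `F = (F₁, …, F_c)` with strict transforms `θ Fᵢ = Y^{dᵢ} gᵢ`, `x^{Σⱼ dᵢⱼ • a j}` dividing a power of `x^m`; and the
SATURATION BINDER `hsat`: `Y^e h ∈ (g₁, …, g_c) ⇒ h ∈ (g₁, …, g_c)`. Conclusion: a BIJECTIVE ring homomorphism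
`k[Y]/(g₁, …, g_c) → R[I_A R/x̄^m]`, `R = k[X]/(F₁, …, F_c)`, which is the chart map on representatives (`q ↦ Ψ_F q`; `θ q ↦ q̄/1`). Kernel:
`(g) ⊆ ker Ψ_F` by §2; `ker Ψ_F ⊆ (θ(F) : Y^∞) ⊆ ((g) : Y^∞) = (g)` by §3 and `hsat`. [folklore] -/
theorem exists_ciChartPresentation :
    ∃ ε : (MvPolynomial (Fin n) k ⧸ Ideal.span (Set.range gs)) →+*
        ↥(Literature.AlgebraicGeometry.Resolution.blowupAlgebra
          (Ideal.span ((fun e : Fin n →₀ ℕ => Ideal.Quotient.mk (Ideal.span (Set.range Fs)) (monomial e (1 : k))) '' (A : Set _)))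
          (Ideal.Quotient.mk (Ideal.span (Set.range Fs)) (monomial m (1 : k)))),
      Function.Bijective ε ∧
      (∀ q : MvPolynomial (Fin n) k, (ε (Ideal.Quotient.mk (Ideal.span (Set.range gs)) q)).val =
        aeval (fun i : Fin n => algebraMap (MvPolynomial (Fin n) k ⧸ Ideal.span (Set.range Fs))
          (Localization.Away (Ideal.Quotient.mk (Ideal.span (Set.range Fs)) (monomial m (1 : k))))
          (Ideal.Quotient.mk (Ideal.span (Set.range Fs)) (monomial (a i) (1 : k))) *
          IsLocalization.Away.invSelf (Ideal.Quotient.mk (Ideal.span (Set.range Fs)) (monomial m (1 : k)))) q) ∧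
      (∀ q : MvPolynomial (Fin n) k, (ε (Ideal.Quotient.mk (Ideal.span (Set.range gs))
          (aeval (fun j : Fin n => ∏ i : Fin n, (X i : MvPolynomial (Fin n) k) ^ V i j) q))).val =
        algebraMap (MvPolynomial (Fin n) k ⧸ Ideal.span (Set.range Fs))
          (Localization.Away (Ideal.Quotient.mk (Ideal.span (Set.range Fs)) (monomial m (1 : k))))
          (Ideal.Quotient.mk (Ideal.span (Set.range Fs)) q)) := by
  set F : Ideal (MvPolynomial (Fin n) k) := Ideal.span (Set.range Fs) with hF
  set R := MvPolynomial (Fin n) k ⧸ F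
  set u : R := Ideal.Quotient.mk F (monomial m (1 : k)) with hu
  set L := Localization.Away u
  set Ψ : MvPolynomial (Fin n) k →ₐ[k] L := aeval (fun i : Fin n => algebraMap R L
    (Ideal.Quotient.mk F (monomial (a i) (1 : k))) * IsLocalization.Away.invSelf u) with hΨ
  set θ : MvPolynomial (Fin n) k →ₐ[k] MvPolynomial (Fin n) k :=
    aeval (fun j : Fin n => ∏ i : Fin n, (X i : MvPolynomial (Fin n) k) ^ V i j) with hθ
  set B := Literature.AlgebraicGeometry.Resolution.blowupAlgebra
    (Ideal.span ((fun e : Fin n →₀ ℕ => Ideal.Quotient.mk F (monomial e (1 : k))) '' (A : Set _))) u with hB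
  have hrange : Set.range (Ψ : MvPolynomial (Fin n) k → L) = (B : Set L) :=
    CIChartPresentationRange.range_psi_eq_blowupAlgebra F V hV m a hgen A haA hge
  have hmemB : ∀ q, Ψ q ∈ B := fun q => by
    rw [← SetLike.mem_coe, ← hrange]; exact ⟨q, rfl⟩
  -- the corestriction of `Ψ` to `B`
  obtain ⟨ψB, hψBval⟩ : ∃ ψ : MvPolynomial (Fin n) k →+* ↥B, ∀ q, (ψ q).val = Ψ q :=
    ⟨{ toFun := fun q => ⟨Ψ q, hmemB q⟩
       map_one' := Subtype.ext (by simp)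
       map_mul' := fun x y => Subtype.ext (by simp)
       map_zero' := Subtype.ext (by simp)
       map_add' := fun x y => Subtype.ext (by simp) }, fun q => rfl⟩
  have hsurj : Function.Surjective ψB := by
    rintro ⟨y, hy⟩
    rw [← SetLike.mem_coe, ← hrange] at hy
    obtain ⟨q, rfl⟩ := hy
    exact ⟨q, Subtype.ext (hψBval q)⟩
  -- the total transform lies in `(g)`
  have hmapF : F.map θ.toRingHom ≤ Ideal.span (Set.range gs) := by
    rw [hF, Ideal.map_span, Ideal.span_le]
    rintro _ ⟨_, ⟨i, rfl⟩, rfl⟩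
    change θ (Fs i) ∈ Ideal.span (Set.range gs)
    rw [hθ, hθF i]
    exact Ideal.mul_mem_left _ _ (Ideal.subset_span ⟨i, rfl⟩)
  have hker : RingHom.ker ψB = Ideal.span (Set.range gs) := by
    apply le_antisymm
    · intro h hh
      rw [RingHom.mem_ker, Subtype.ext_iff, hψBval] at hh
      obtain ⟨e, he⟩ := exists_monomial_mul_mem_map_of_psi_eq_zero F V m a hgen h hh
      exact hsat e h (hmapF he)
    · rw [Ideal.span_le]
      rintro _ ⟨i, rfl⟩
      rw [SetLike.mem_coe, RingHom.mem_ker, Subtype.ext_iff, hψBval]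
      exact psi_eq_zero_of_theta_eq F V hV m a hgen (hF ▸ Ideal.subset_span ⟨i, rfl⟩) (hθF i) (hunit i)
  have hvan : ∀ h ∈ Ideal.span (Set.range gs), ψB h = 0 := fun h hh => by
    rw [← hker] at hh
    exact hh
  have hinj : Function.Injective (Ideal.Quotient.lift (Ideal.span (Set.range gs)) ψB hvan) :=
    RingHom.lift_injective_of_ker_le_ideal (Ideal.span (Set.range gs)) hvan hker.le
  have hsφ : Function.Surjective (Ideal.Quotient.lift (Ideal.span (Set.range gs)) ψB hvan) :=
    Ideal.Quotient.lift_surjective_of_surjective (Ideal.span (Set.range gs)) hvan hsurj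
  have hev : ∀ q : MvPolynomial (Fin n) k,
      (Ideal.Quotient.lift (Ideal.span (Set.range gs)) ψB hvan) (Ideal.Quotient.mk (Ideal.span (Set.range gs)) q) = ψB q :=
    fun q => Ideal.Quotient.lift_mk _ _ _
  have hpt : ∀ q : MvPolynomial (Fin n) k, Ψ (θ q) = algebraMap R L (Ideal.Quotient.mk F q) := fun q =>
    CIChartPresentationRange.psi_theta F V hV m a hgen q
  refine ⟨Ideal.Quotient.lift (Ideal.span (Set.range gs)) ψB hvan, ⟨hinj, hsφ⟩, fun q => ?_, fun q => ?_⟩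
  · rw [hev, hψBval]
  · rw [hev, hψBval]
    exact hpt q

end Presentation

end Summit.ResolutionOfSingularities.ResolutionOfSingularities.Theorems.FInjectiveMacaulayfication.CIChartPresentationKernel

end
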